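import Literature.AnabelianGeometry.EtaleTheta.CyclotomeZHatEquiv
import Literature.AnabelianGeometry.AbsoluteAnabelian.AbsTopIII.CyclotomeAutomorphisms
import HarnessLib

/-!
# `Aut(Λ(R^×)) = Ẑ^×` on the nose: every automorphism of the cyclotome is a `Ẑ^×`-twist (proof-only)

Sources.  S. Mochizuki, *Topics in Absolute Anabelian Geometry III*, Def. 3.1 (v) p. 69 ("the cyclotome … is
isomorphic to `Ẑ`"), Prop. 3.3 (ii) pp. 73–74 ("the natural action of `Ẑ^×` on `M`"; kurims manuscript, lit key
`paper:url-5493eb38cbb7`) [MochizukiAbsTopIII2015]; classical profinite group theory [RibesZalesskii2010,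
Thm 2.7.1] (`Ẑ = lim ℤ/nℤ`, `Aut(Ẑ) = Ẑ^×`); LANA Project interim report §6.1 p. 32 [LANA2026Report] (the
functoriality `Λ(f)` of the cyclotome `Λ(M) = lim M[n]`).  PROOF-ONLY: theorems, no definition, no new fact.

**What was in the tree.**  `cyclotome.zhatTwist A : Aut(Ẑ) →* Aut(Λ(A))` — the `Ẑ^×`-ACTION on the cyclotome
of any commutative group `A` (abc-iut-w4-d024, `CyclotomeZHatAction.lean`); `ZHatLevel.eq_of_levelChar_eq` —
`Aut(Ẑ)` is determined by its cyclotomic characters (`ZHatLevelDetermination.lean`);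
`cyclotome.exists_generator_mulEquiv_zHat` — for a domain `R` with primitive roots of unity of every order,
`Λ(R^×) ≃* Ẑ` with a generator `ξ ↦ η(1)` and `ζ_n = ξ_n ^ level_n(e ζ)` (abc-iut-w5-d010,
`CyclotomeZHatEquiv.lean`); `cyclotome_map_apply_congr` — an endomorphism of `Λ(A)` acts level by level
(abc-iut-L6-d1, `AbsTopIII/CyclotomeAutomorphisms.lean`, whose `MLFClosure.cyclotome_mulEquiv_exponents` is the
exponent-system form of the present theorem for the model `k̄` of an MLF).

**What this file proves** (for a domain `R` with a primitive `n`-th root of unity for every `n ≥ 1`, e.g. any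
separably closed field of characteristic `0`):
* `cyclotome.exists_zhatTwist_eq` — **every abstract group automorphism `w` of `Λ(R^×)` is the twist by some
  `u ∈ Ẑ^× = Aut(Ẑ)`**: `w ζ = zhatTwist u ζ` for all `ζ` (transport `w` to `Ẑ` along `e`; an abstract
  endomorphism of `Ẑ` is multiplication by a scalar at every level, `ZHatLevel.toAdd_level_aut`);
* `cyclotome.zhatTwist_injective` — the twist is FAITHFUL (`u` is recovered from its action on a generator),
  so `u` is unique: `cyclotome.existsUnique_zhatTwist_eq` — **`Aut(Ẑ) ⥲ Aut(Λ(R^×))`**;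
* `cyclotome.existsUnique_zhatTwist_eq_map` — the **cyclotomic character** of an automorphism `σ` of the
  group `R^×` [e.g. a field / Galois / pseudo-monoid automorphism]: there is a unique `χ(σ) ∈ Ẑ^×` with
  `Λ(σ) = zhatTwist χ(σ)`, i.e. `σ(ζ_n) = ζ_n ^ χ_n(σ)` for every compatible system of roots of unity;
* the `…_of_isSepClosed` specialisations (Mathlib `HasEnoughRootsOfUnity`).

Consumers (abc-iut cell; nothing of theirs is edited): law (a) "Kummer naturality" of [IUTchI] Ex. 5.1 (v)
(GAP-LEDGER G-w4d056-2; `CoricPair.kummerRigid_of_divisors`, `GlobalFrobenioidsCoricRigidityOfDivisors.lean`) —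
the multiplier `u_e ∈ Ẑ^×` of an automorphism `e` of the pair IS `χ(μ_Ẑ(e))`; the torsor hypothesis (T) of
`UniqueCyclotomeIso.of_laws` (abc-iut-w5-d110, `GlobalFrobenioidsCyclotomeIsoOfLaws.lean`); the `Ẑ^×`-orbit of
[IUTchII] Cor. 1.11 (a) (`GalTwistInput`, abc-iut-L6).  HONEST FRAMING: OUR kernel check of classical statements;
nothing here bears on [IUTchIII] Cor. 3.12; no side is taken on any disputed claim.
-/

noncomputable section

open CategoryTheory ProfiniteGrp ProfiniteGrp.ProfiniteCompletion

namespace Literature.AnabelianGeometry.EtaleTheta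

namespace cyclotome

universe u

variable {R : Type u} [CommRing R] [IsDomain R]

/-! ## Every automorphism of `Λ(R^×)` is a `Ẑ^×`-twist -/

/-- **`Aut(Λ(R^×)) ⊆ Ẑ^×`.**  Let `R` be a domain with a primitive `n`-th root of unity for every `n ≥ 1`.  Every
abstract group automorphism `w` of the cyclotome `Λ(R^×) = lim_n μ_n(R)` is the twist by an element `u` of
`Ẑ^× = Aut(Ẑ)`: `w ζ = u · ζ`, i.e. `(w ζ)_n = ζ_n ^ χ_n(u)` for all `ζ` and `n` ("the cyclotome … is isomorphic
to `Ẑ`", so its automorphisms are the units of `Ẑ`).  PROOF: transport `w` along a generator-normalised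
isomorphism `e : Λ(R^×) ≃* Ẑ` (`exists_generator_mulEquiv_zHat`); `u := e⁻¹ ≫ w ≫ e` acts on the level `n` by the
scalar `χ_n(u) = level_n(e(w ξ))`, and `w` acts level by level (`cyclotome_map_apply_congr`).
[cite: MochizukiAbsTopIII2015, Definition 3.1 (v) p.69] -/
theorem exists_zhatTwist_eq (hprim : ∀ n : ℕ, 0 < n → ∃ ζ : R, IsPrimitiveRoot ζ n)
    (w : cyclotome Rˣ ≃* cyclotome Rˣ) :
    ∃ u : MulAut (completion (GrpCat.of (Multiplicative ℤ))), ∀ ζ : cyclotome Rˣ, w ζ = zhatTwist Rˣ u ζ := by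
  obtain ⟨ξ, e, hξ, heξ, hlog⟩ := exists_generator_mulEquiv_zHat hprim
  refine ⟨(e.symm.trans w).trans e, fun ζ => ?_⟩
  apply Subtype.ext
  funext n
  haveI : NeZero (n : ℕ) := ⟨n.ne_zero⟩
  -- the level-`n` character of `u := e⁻¹ ≫ w ≫ e` is the discrete logarithm of `(w ξ)_n` to the base `ξ_n`
  have hsymm : e.symm (ZHatLevel.eta 1) = ξ := (MulEquiv.symm_apply_eq e).2 heξ.symm
  have hchar : ZHatLevel.levelChar n ((e.symm.trans w).trans e) =
      Multiplicative.toAdd (ZHatLevel.level n (e (w ξ))) := by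
    rw [ZHatLevel.levelChar_apply, MulEquiv.trans_apply, MulEquiv.trans_apply, hsymm]
  rw [zhatTwist_apply_coe, hchar]
  -- discrete logarithms of `(w ξ)_n` and `ζ_n` to the base `ξ_n`
  set c := (Multiplicative.toAdd (ZHatLevel.level n (e (w ξ)))).val with hc_def
  set d := (Multiplicative.toAdd (ZHatLevel.level n (e ζ))).val with hd_def
  have hc : (ξ : ℕ+ → Rˣ) n ^ c = ((w ξ : cyclotome Rˣ) : ℕ+ → Rˣ) n := hlog (w ξ) n
  have hd : (ξ : ℕ+ → Rˣ) n ^ d = (ζ : ℕ+ → Rˣ) n := hlog ζ n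
  -- `w` acts level by level: `(w ζ)_n = (w (ξ ^ d))_n = (w ξ)_n ^ d`
  have hξd : ((ξ ^ d : cyclotome Rˣ) : ℕ+ → Rˣ) n = (ξ : ℕ+ → Rˣ) n ^ d := rfl
  have h1 : ((w ζ : cyclotome Rˣ) : ℕ+ → Rˣ) n = ((w (ξ ^ d) : cyclotome Rˣ) : ℕ+ → Rˣ) n :=
    Literature.AnabelianGeometry.AbsoluteAnabelian.cyclotome_map_apply_congr w.toMonoidHom ζ (ξ ^ d) n
      (by rw [hξd, hd])
  have h2 : ((w (ξ ^ d) : cyclotome Rˣ) : ℕ+ → Rˣ) n = ((w ξ : cyclotome Rˣ) : ℕ+ → Rˣ) n ^ d := by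
    rw [map_pow]; rfl
  change ((w ζ : cyclotome Rˣ) : ℕ+ → Rˣ) n = (ζ : ℕ+ → Rˣ) n ^ c
  rw [h1, h2, ← hc, ← hd, ← pow_mul, ← pow_mul, mul_comm]

/-! ## Faithfulness: the twisting element is unique -/

/-- **The `Ẑ^×`-action on `Λ(R^×)` is faithful**: `u ∈ Aut(Ẑ)` is determined by its twist (compare the actions on
a generator `ξ` — every `ξ_n` a primitive `n`-th root — and use that `Aut(Ẑ)` is determined by its level
characters, `ZHatLevel.eq_of_levelChar_eq`). [cite: MochizukiAbsTopIII2015, Definition 3.1 (v) p.69] -/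
theorem zhatTwist_injective (hprim : ∀ n : ℕ, 0 < n → ∃ ζ : R, IsPrimitiveRoot ζ n) :
    Function.Injective (zhatTwist Rˣ :
      MulAut (completion (GrpCat.of (Multiplicative ℤ))) → MulAut (cyclotome Rˣ)) := by
  intro u v huv
  obtain ⟨ξ, hξ⟩ := exists_generator hprim
  apply ZHatLevel.eq_of_levelChar_eq
  intro n
  haveI : NeZero (n : ℕ) := ⟨n.ne_zero⟩
  have h : ((zhatTwist Rˣ u ξ : cyclotome Rˣ) : ℕ+ → Rˣ) n = ((zhatTwist Rˣ v ξ : cyclotome Rˣ) : ℕ+ → Rˣ) n := by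
    rw [huv]
  rw [zhatTwist_apply_coe, zhatTwist_apply_coe] at h
  have hmod := (pow_eq_pow_iff_mod_eq (hξ n) _ _).mp h
  rw [Nat.mod_eq_of_lt (ZMod.val_lt _), Nat.mod_eq_of_lt (ZMod.val_lt _)] at hmod
  exact ZMod.val_injective n hmod

/-- Pointwise form of faithfulness: two elements of `Ẑ^×` twisting every `ζ ∈ Λ(R^×)` alike are equal.
[cite: MochizukiAbsTopIII2015, Definition 3.1 (v) p.69] -/
theorem eq_of_zhatTwist_eq (hprim : ∀ n : ℕ, 0 < n → ∃ ζ : R, IsPrimitiveRoot ζ n)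
    {u v : MulAut (completion (GrpCat.of (Multiplicative ℤ)))}
    (h : ∀ ζ : cyclotome Rˣ, zhatTwist Rˣ u ζ = zhatTwist Rˣ v ζ) : u = v :=
  zhatTwist_injective hprim (MulEquiv.ext h)

/-- **`Aut(Ẑ) ⥲ Aut(Λ(R^×))`, i.e. `Aut(Λ(R^×)) = Ẑ^×` on the nose**: for every abstract group automorphism `w`
of the cyclotome there is EXACTLY ONE `u ∈ Ẑ^× = Aut(Ẑ)` with `w = zhatTwist u` (existence
`exists_zhatTwist_eq`, uniqueness `zhatTwist_injective`).  In particular abstract automorphisms of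
`μ_Ẑ(K̄) ≅ Ẑ(1)` are automatically "continuous". [cite: MochizukiAbsTopIII2015, Proposition 3.3 (ii) p.74] -/
theorem existsUnique_zhatTwist_eq (hprim : ∀ n : ℕ, 0 < n → ∃ ζ : R, IsPrimitiveRoot ζ n)
    (w : cyclotome Rˣ ≃* cyclotome Rˣ) :
    ∃! u : MulAut (completion (GrpCat.of (Multiplicative ℤ))), zhatTwist Rˣ u = w := by
  obtain ⟨u, hu⟩ := exists_zhatTwist_eq hprim w
  exact ⟨u, MulEquiv.ext fun ζ => (hu ζ).symm, fun v hv => zhatTwist_injective hprim (hv.trans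
    (MulEquiv.ext fun ζ => (hu ζ).symm).symm)⟩

/-- Surjectivity packaged: the twist homomorphism `Ẑ^× → Aut(Λ(R^×))` is a BIJECTION.
[cite: MochizukiAbsTopIII2015, Proposition 3.3 (ii) p.74] -/
theorem zhatTwist_bijective (hprim : ∀ n : ℕ, 0 < n → ∃ ζ : R, IsPrimitiveRoot ζ n) :
    Function.Bijective (zhatTwist Rˣ :
      MulAut (completion (GrpCat.of (Multiplicative ℤ))) → MulAut (cyclotome Rˣ)) :=
  ⟨zhatTwist_injective hprim, fun w => (existsUnique_zhatTwist_eq hprim w).exists.imp fun _ h => h⟩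

/-! ## The cyclotomic character of an automorphism of `R^×` -/

/-- **The cyclotomic character `χ(σ) ∈ Ẑ^×` of an automorphism `σ` of the group `R^×`** (e.g. the restriction
of a field automorphism, of a Galois element, or of an automorphism of a cyclotomic pseudo-monoid containing the
roots of unity): `Λ(σ)` — the componentwise action of `σ` on compatible systems of roots of unity — is the twist by
a UNIQUE `u ∈ Ẑ^×`: `σ(ζ_n) = ζ_n ^ χ_n(u)` for all `ζ ∈ Λ(R^×)`, `n ≥ 1`.  This is the element of `Aut(μ_Ẑ) = Ẑ^×`
through which an automorphism of a Kummer-theoretic pair acts on Kummer classes ("the natural action of `Ẑ^×`").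
[cite: MochizukiAbsTopIII2015, Proposition 3.3 (ii) p.74] -/
theorem existsUnique_zhatTwist_eq_map (hprim : ∀ n : ℕ, 0 < n → ∃ ζ : R, IsPrimitiveRoot ζ n)
    (σ : Rˣ ≃* Rˣ) :
    ∃! u : MulAut (completion (GrpCat.of (Multiplicative ℤ))),
      ∀ ζ : cyclotome Rˣ, cyclotome.map σ.toMonoidHom ζ = zhatTwist Rˣ u ζ := by
  -- `Λ(σ)` is an automorphism with inverse `Λ(σ⁻¹)`
  have h₁ : (cyclotome.map σ.symm.toMonoidHom).comp (cyclotome.map σ.toMonoidHom) =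
      MonoidHom.id (cyclotome Rˣ) :=
    MonoidHom.ext fun ζ => Subtype.ext (funext fun n => by simp)
  have h₂ : (cyclotome.map σ.toMonoidHom).comp (cyclotome.map σ.symm.toMonoidHom) =
      MonoidHom.id (cyclotome Rˣ) :=
    MonoidHom.ext fun ζ => Subtype.ext (funext fun n => by simp)
  set W : cyclotome Rˣ ≃* cyclotome Rˣ :=
    MonoidHom.toMulEquiv (cyclotome.map σ.toMonoidHom) (cyclotome.map σ.symm.toMonoidHom) h₁ h₂ with hW
  have hWapp : ∀ ζ, W ζ = cyclotome.map σ.toMonoidHom ζ := fun ζ => rfl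
  obtain ⟨u, hu, huniq⟩ := existsUnique_zhatTwist_eq hprim W
  refine ⟨u, fun ζ => ?_, fun v hv => huniq v (MulEquiv.ext fun ζ => ?_)⟩
  · rw [← hWapp, ← hu]
  · rw [hWapp, hv ζ]

/-- Componentwise reading of the cyclotomic character: `σ(ζ_n) = ζ_n ^ χ_n(u)` for every compatible system of
roots of unity `ζ` and every level `n`. [cite: MochizukiAbsTopIII2015, Proposition 3.3 (ii) p.74] -/
theorem exists_apply_eq_pow_levelChar (hprim : ∀ n : ℕ, 0 < n → ∃ ζ : R, IsPrimitiveRoot ζ n)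
    (σ : Rˣ ≃* Rˣ) :
    ∃ u : MulAut (completion (GrpCat.of (Multiplicative ℤ))), ∀ (ζ : cyclotome Rˣ) (n : ℕ+),
      σ ((ζ : ℕ+ → Rˣ) n) = (ζ : ℕ+ → Rˣ) n ^ (ZHatLevel.levelChar n u).val := by
  obtain ⟨u, hu, -⟩ := existsUnique_zhatTwist_eq_map hprim σ
  refine ⟨u, fun ζ n => ?_⟩
  have h := congrArg (fun ξ : cyclotome Rˣ => (ξ : ℕ+ → Rˣ) n) (hu ζ)
  simpa only [map_apply, zhatTwist_apply_coe, MulEquiv.coe_toMonoidHom] using h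

/-! ## Separably closed fields of characteristic `0` -/

/-- **`Aut(Λ(K^×)) = Ẑ^×` for `K` separably closed of characteristic `0`** (so for every algebraic closure
`K̄` of a field of characteristic `0`: `Aut(μ_Ẑ(K̄)) = Ẑ^×`): every automorphism of the cyclotome is the twist by
exactly one `u ∈ Aut(Ẑ)`. [cite: MochizukiAbsTopIII2015, Proposition 3.3 (ii) p.74] -/
theorem existsUnique_zhatTwist_eq_of_isSepClosed (K : Type u) [Field K] [IsSepClosed K] [CharZero K]
    (w : cyclotome Kˣ ≃* cyclotome Kˣ) :
    ∃! u : MulAut (completion (GrpCat.of (Multiplicative ℤ))), zhatTwist Kˣ u = w :=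
  existsUnique_zhatTwist_eq (exists_isPrimitiveRoot_of_isSepClosed K) w

/-- The `Ẑ^×`-action on `Λ(K^×)` is a bijection `Aut(Ẑ) → Aut(Λ(K^×))`, `K` separably closed of characteristic
`0`. [cite: MochizukiAbsTopIII2015, Proposition 3.3 (ii) p.74] -/
theorem zhatTwist_bijective_of_isSepClosed (K : Type u) [Field K] [IsSepClosed K] [CharZero K] :
    Function.Bijective (zhatTwist Kˣ :
      MulAut (completion (GrpCat.of (Multiplicative ℤ))) → MulAut (cyclotome Kˣ)) :=
  zhatTwist_bijective (exists_isPrimitiveRoot_of_isSepClosed K)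

/-- **The cyclotomic character of an automorphism of `K^×`**, `K` separably closed of characteristic `0`: for
`σ : K^× ≃* K^×` there is a unique `χ(σ) ∈ Ẑ^×` with `Λ(σ) = zhatTwist χ(σ)`.
[cite: MochizukiAbsTopIII2015, Proposition 3.3 (ii) p.74] -/
theorem existsUnique_zhatTwist_eq_map_of_isSepClosed (K : Type u) [Field K] [IsSepClosed K] [CharZero K]
    (σ : Kˣ ≃* Kˣ) :
    ∃! u : MulAut (completion (GrpCat.of (Multiplicative ℤ))),
      ∀ ζ : cyclotome Kˣ, cyclotome.map σ.toMonoidHom ζ = zhatTwist Kˣ u ζ :=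
  existsUnique_zhatTwist_eq_map (exists_isPrimitiveRoot_of_isSepClosed K) σ

end cyclotome

end Literature.AnabelianGeometry.EtaleTheta

end
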